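import Literature.MathematicalPhysics.QuantumFieldTheory.Balaban1983to89.B3Sect2StatementsPart2

/-!
# `Balaban1983to89.B3IndexNetworks` — T. Bałaban, *(Higgs)₂,₃ quantum fields in a finite volume. III. Renormalization*,
Commun. Math. Phys. **88** (1983) 411–445 [Balaban1983Higgs3]: the kernel of the p. 434 vanishing argument — contraction of
internal-index networks whose edges carry powers of the charge matrix q, and *"tr q^{2n+1} = 0"*

statement-level skeleton of published theorems with citation tags; proofs where landed; nothing here is a claim about the Yang–Mills mass gap

PDF held: `paper:balaban1983-higgs-2-3-quantum-fields-finite-volume` (journal page = PDF page + 410); render read as image: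
`run/shared/lean/pub/pub-balaban/b2b-balaban-ref1/pages/1983-cmp88-higgs23-III/1983-cmp88-higgs23-III-p024-x2.png` (p. 434).
CITATION HEADER (lean-in-tree rule).  lit-balaban TYPED SKELETON (HOME `run/shared/lean/pub/lit-balaban/`), Phase 2, seat p18
(gen 4), unit `lit-balaban-p18`: SKELETON row **B3.Txt@434** (owner r15), p. 434 [PDF 24], verbatim: *"At first let us remark that
the expressions corresponding to graphs with an odd number of external vector field legs (and no other external legs) are equal
to 0. This follows from the fact that every graph of this type has at least one loop of scalar field lines with an odd number of
vector field legs, thus with an odd power of q, and we have tr q^{2n+1} = 0."*  The graph-theoretic half (an odd loop exists) is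
`B3OddVectorLoops.exists_odd_loop` (p18 gen 2); the algebraic half tr q^{2n+1} = 0 is r15's
`B3Sect2StatementsPart2.trace_pow_odd_eq_zero_of_transpose_eq_neg`.  THIS MODULE supplies the step between them (the internal
index sum around a closed loop of scalar lines is a trace); the sibling `B3OddVectorLoopsVanish` applies it to `B3Cor23Concrete`.

WHAT IS FORMALISED (sorry-free; `def`s with bodies only, no `Prop` fact).  An *index network* is a multiset of directed edges
between nodes of a finite type `P`; the edge `e` carries the N × N matrix `e.coef • q ^ e.pow` (`Edge.mat`; in the application a
bilinear form ⟨φ′, q^{n+n′}φ′⟩ of a vertex (1.7)–(1.11) is an edge with power n + n′ between its two φ′-legs, the two forms of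
|φ′|⁴ (1.6) and every scalar line G_k(0)δ_{aa′} are edges with power 0).  `eval q L` = Σ over all assignments b : P → (indices) of
Π_e (e.mat q)(b(src e), b(tgt e)).  Kernel identities: reversing an edge transposes its matrix, = (−1)^pow · itself for
antisymmetric q (`eval_flip`); summing out a node met by exactly two edge-ends composes the two matrices (`eval_merge`) or, for
a self-loop, takes the trace (`eval_loop`).  MAIN THEOREM `eval_eq_zero_of_odd_closed`: q antisymmetric, C a set of nodes closed
under the edges, each met by exactly two edge-ends (the edges inside C form closed loops), carrying an ODD total power of q ⇒
`eval q L = 0` (induction on |C|: the loops inside C contract to self-loops ± q^{(power of the loop)}, one of them odd, *"and we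
have tr q^{2n+1} = 0"*).  Non-vacuity: `eval_twoCycle` (an even loop gives tr q² = −2 ≠ 0 for the charge matrix of the model).
-/

namespace Literature.MathematicalPhysics.QuantumFieldTheory.Balaban1983to89.B3IndexNetworks

open Finset Matrix

/-! ## Index networks -/

/-- An edge of an internal-index network: it joins the node `src` to the node `tgt` and carries the matrix
`coef • q ^ pow` (a bilinear form ⟨·, q^{n+n′}·⟩ of a vertex, p. 413, or a scalar line δ_{aa′} = q⁰).
[cite: Balaban1983Higgs3, p.434] -/
structure Edge (P : Type*) where
  /-- the node of the first (row) index -/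
  src : P
  /-- the node of the second (column) index -/
  tgt : P
  /-- an integer coefficient (signs produced by transposition) -/
  coef : ℤ
  /-- the power of the charge matrix q carried by the edge -/
  pow : ℕ

namespace Edge

variable {P : Type*} {n : Type*} [Fintype n] [DecidableEq n]

/-- The matrix `coef • q ^ pow` of an edge. [cite: Balaban1983Higgs3, p.434] -/
def mat (q : Matrix n n ℝ) (e : Edge P) : Matrix n n ℝ := (e.coef : ℝ) • q ^ e.pow

/-- The reversed edge: the transpose of `coef • q^pow` is `coef (−1)^pow • q^pow` for antisymmetric q.
[cite: Balaban1983Higgs3, p.434] -/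
def flip (e : Edge P) : Edge P := ⟨e.tgt, e.src, e.coef * (-1) ^ e.pow, e.pow⟩

/-- The composite of two consecutive edges `e : p → p′`, `e′ : p′ → r`: matrix product = product of coefficients, sum of powers.
[cite: Balaban1983Higgs3, p.434] -/
def merge (e e' : Edge P) : Edge P := ⟨e.src, e'.tgt, e.coef * e'.coef, e.pow + e'.pow⟩

/-- kernel: powers of an antisymmetric matrix are symmetric or antisymmetric according to the parity of the power —
(q^k)ᵀ = (−1)^k q^k. [cite: Balaban1983Higgs3, p.434] -/
theorem transpose_pow_of_transpose_eq_neg (q : Matrix n n ℝ) (hq : q.transpose = -q) (k : ℕ) :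
    (q ^ k).transpose = ((-1 : ℝ) ^ k) • q ^ k := by
  rw [Matrix.transpose_pow, hq, ← neg_one_smul ℝ q, smul_pow]

/-- kernel: the matrix element of the reversed edge is the transposed matrix element (qᵀ = −q).
[cite: Balaban1983Higgs3, p.434] -/
theorem mat_flip (q : Matrix n n ℝ) (hq : q.transpose = -q) (e : Edge P) (i j : n) :
    e.flip.mat q i j = e.mat q j i := by
  have ht : (q ^ e.pow) j i = (q ^ e.pow).transpose i j := rfl
  rw [mat, mat, Matrix.smul_apply, Matrix.smul_apply, ht, transpose_pow_of_transpose_eq_neg q hq, Matrix.smul_apply]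
  simp only [flip, smul_eq_mul, Int.cast_mul, Int.cast_pow, Int.cast_neg, Int.cast_one]
  ring

/-- kernel: the matrix of the composite edge is the product of the matrices. [cite: Balaban1983Higgs3, p.434] -/
theorem mat_merge (q : Matrix n n ℝ) (e e' : Edge P) : (e.merge e').mat q = e.mat q * e'.mat q := by
  simp only [mat, merge, Int.cast_mul, pow_add, Matrix.smul_mul, Matrix.mul_smul, smul_smul]
  congr 1
  ring

/-- kernel: the trace of an edge matrix with an odd power vanishes — *"we have tr q^{2n+1} = 0"* (r15's
`trace_pow_odd_eq_zero_of_transpose_eq_neg`). [cite: Balaban1983Higgs3, p.434] -/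
theorem trace_mat_eq_zero (q : Matrix n n ℝ) (hq : q.transpose = -q) (e : Edge P) (hodd : Odd e.pow) :
    (e.mat q).trace = 0 := by
  obtain ⟨k, hk⟩ := hodd
  rw [mat, Matrix.trace_smul, hk, B3Sect2StatementsPart2.trace_pow_odd_eq_zero_of_transpose_eq_neg q hq k, smul_zero]

end Edge

variable {P : Type*} {n : Type*} [Fintype n] [DecidableEq n]

/-- The weight of an index assignment `b` (an internal index for every node): the product over the edges of the matrix elements
(e.mat)(b(src e), b(tgt e)). [cite: Balaban1983Higgs3, p.434] -/
def weight (q : Matrix n n ℝ) (L : Multiset (Edge P)) (b : P → n) : ℝ :=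
  (L.map fun e => e.mat q (b e.src) (b e.tgt)).prod

/-- kernel: weight of a network with a distinguished edge. [cite: Balaban1983Higgs3, p.434] -/
theorem weight_cons (q : Matrix n n ℝ) (e : Edge P) (L : Multiset (Edge P)) (b : P → n) :
    weight q (e ::ₘ L) b = e.mat q (b e.src) (b e.tgt) * weight q L b := by
  simp [weight]

variable [DecidableEq P]

/-- The number of edge-ends at the node `p` (a self-loop at `p` counts twice). [cite: Balaban1983Higgs3, p.434] -/
def deg (L : Multiset (Edge P)) (p : P) : ℕ := L.countP (fun e => e.src = p) + L.countP (fun e => e.tgt = p)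

/-- The total power of q carried by the edges issuing from the node set `C`. [cite: Balaban1983Higgs3, p.434] -/
def powIn (L : Multiset (Edge P)) (C : Finset P) : ℕ := (L.map fun e => if e.src ∈ C then e.pow else 0).sum

/-! ## Elementary bookkeeping -/

/-- kernel: edge-ends of a network with a distinguished edge. [cite: Balaban1983Higgs3, p.434] -/
theorem deg_cons (e : Edge P) (L : Multiset (Edge P)) (p : P) :
    deg (e ::ₘ L) p = deg L p + (if e.src = p then 1 else 0) + (if e.tgt = p then 1 else 0) := by
  simp only [deg, Multiset.countP_cons]; ring

/-- kernel: powers of a network with a distinguished edge. [cite: Balaban1983Higgs3, p.434] -/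
theorem powIn_cons (e : Edge P) (L : Multiset (Edge P)) (C : Finset P) :
    powIn (e ::ₘ L) C = (if e.src ∈ C then e.pow else 0) + powIn L C := by
  simp [powIn]

/-- kernel: a node with no edge-ends is avoided by every edge. [cite: Balaban1983Higgs3, p.434] -/
theorem avoid_of_deg_eq_zero {L : Multiset (Edge P)} {p : P} (h : deg L p = 0) :
    ∀ e ∈ L, e.src ≠ p ∧ e.tgt ≠ p := by
  obtain ⟨h1, h2⟩ := Nat.add_eq_zero_iff.mp h
  rw [Multiset.countP_eq_zero] at h1 h2
  exact fun e he => ⟨h1 e he, h2 e he⟩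

/-- kernel: the weight does not depend on the index of a node avoided by every edge. [cite: Balaban1983Higgs3, p.434] -/
theorem weight_update_of_avoid (q : Matrix n n ℝ) {L : Multiset (Edge P)} {p : P} (h : ∀ e ∈ L, e.src ≠ p ∧ e.tgt ≠ p)
    (b : P → n) (j : n) : weight q L (Function.update b p j) = weight q L b := by
  unfold weight
  rw [Multiset.map_congr rfl fun e he => by rw [Function.update_of_ne (h e he).1, Function.update_of_ne (h e he).2]]

/-- kernel: if no edge issues from `C`, the power carried by `C` is 0. [cite: Balaban1983Higgs3, p.434] -/
theorem powIn_eq_zero_of_forall {L : Multiset (Edge P)} {C : Finset P} (h : ∀ e ∈ L, e.src ∉ C) : powIn L C = 0 := by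
  refine Multiset.sum_eq_zero fun x hx => ?_
  obtain ⟨e, he, rfl⟩ := Multiset.mem_map.mp hx
  simp [h e he]

/-- kernel: the power carried by a node set depends only on which sources lie in it. [cite: Balaban1983Higgs3, p.434] -/
theorem powIn_congr {L : Multiset (Edge P)} {C C' : Finset P} (h : ∀ e ∈ L, (e.src ∈ C ↔ e.src ∈ C')) :
    powIn L C = powIn L C' := by
  unfold powIn
  rw [Multiset.map_congr rfl fun e he => show (if e.src ∈ C then e.pow else 0) = if e.src ∈ C' then e.pow else 0 by
    by_cases hc : e.src ∈ C
    · rw [if_pos hc, if_pos ((h e he).mp hc)]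
    · rw [if_neg hc, if_neg (fun hc' => hc ((h e he).mpr hc'))]]

/-- kernel: if the node `p′` has exactly two edge-ends, one the head of an edge `e` with tail elsewhere, the remaining edges meet
`p′` exactly once — by a tail (first alternative) or a head (second) of an edge whose other end is elsewhere.
[cite: Balaban1983Higgs3, p.434] -/
theorem exists_other_end {e : Edge P} {L : Multiset (Edge P)} {p' : P} (he : e.tgt = p') (hp : e.src ≠ p')
    (hdeg : deg (e ::ₘ L) p' = 2) :
    ∃ e' L', (e'.src = p' ∧ e'.tgt ≠ p' ∧ L = e' ::ₘ L' ∧ ∀ f ∈ L', f.src ≠ p' ∧ f.tgt ≠ p') ∨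
      (e'.tgt = p' ∧ e'.src ≠ p' ∧ L = e' ::ₘ L' ∧ ∀ f ∈ L', f.src ≠ p' ∧ f.tgt ≠ p') := by
  rw [deg_cons, if_neg hp, if_pos he, deg] at hdeg
  rcases Nat.eq_zero_or_pos (L.countP fun f => f.src = p') with h0 | hpos
  · obtain ⟨e', he'L, he't⟩ := Multiset.countP_pos.mp (show 0 < L.countP (fun f => f.tgt = p') by omega)
    obtain ⟨L', rfl⟩ := Multiset.exists_cons_of_mem he'L -- the other end is a head
    rw [Multiset.countP_cons, Multiset.countP_cons, if_pos he't] at hdeg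
    rw [Multiset.countP_cons] at h0
    have hs' : e'.src ≠ p' := fun h => by rw [if_pos h] at h0; omega
    rw [if_neg hs'] at h0 hdeg
    exact ⟨e', L', Or.inr ⟨he't, hs', rfl, avoid_of_deg_eq_zero (by unfold deg; omega)⟩⟩
  · obtain ⟨e', he'L, he's⟩ := Multiset.countP_pos.mp hpos
    obtain ⟨L', rfl⟩ := Multiset.exists_cons_of_mem he'L -- the other end is a tail
    rw [Multiset.countP_cons, Multiset.countP_cons, if_pos he's] at hdeg
    have ht' : e'.tgt ≠ p' := fun h => by rw [if_pos h] at hdeg; omega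
    rw [if_neg ht'] at hdeg
    exact ⟨e', L', Or.inl ⟨he's, ht', rfl, avoid_of_deg_eq_zero (by unfold deg; omega)⟩⟩

/-- The re-assignment map (b, j) ↦ (b[p ↦ j], b p) on (assignments) × (indices). [cite: Balaban1983Higgs3, p.434] -/
def reassign (p : P) (x : (P → n) × n) : (P → n) × n := (Function.update x.1 p x.2, x.1 p)

omit [Fintype n] [DecidableEq n] in
/-- kernel: re-assignment is an involution. [cite: Balaban1983Higgs3, p.434] -/
theorem reassign_involutive (p : P) : Function.Involutive (reassign (n := n) p) := by
  rintro ⟨b, j⟩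
  simp only [reassign, Function.update_self, Function.update_idem, Function.update_eq_self]

variable [Fintype P]

/-- The value of the index network: the sum over all index assignments of the weights (the internal-index sum of a product of
bilinear forms and Kronecker deltas). [cite: Balaban1983Higgs3, p.434] -/
def eval (q : Matrix n n ℝ) (L : Multiset (Edge P)) : ℝ := ∑ b : P → n, weight q L b

/-! ## Summing out one node -/

omit [DecidableEq n] in
/-- kernel: summing a function of index assignments over the re-assignments of one node multiplies the plain sum by the number
of index values (re-assignment is a bijection of (assignments) × (indices)). [cite: Balaban1983Higgs3, p.434] -/
theorem sum_sum_update (p : P) (F : (P → n) → ℝ) :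
    ∑ b : P → n, ∑ j : n, F (Function.update b p j) = (Fintype.card n : ℝ) * ∑ b : P → n, F b := by
  have h := Equiv.sum_comp ((reassign_involutive p).toPerm (reassign p)) (fun x => F x.1)
  simp only [Function.Involutive.coe_toPerm, reassign, Fintype.sum_prod_type, Finset.sum_const, Finset.card_univ,
    nsmul_eq_mul] at h
  rw [h, Finset.mul_sum]

/-- kernel (reversal): replacing an edge by the reversed edge does not change the value, for antisymmetric q.
[cite: Balaban1983Higgs3, p.434] -/
theorem eval_flip (q : Matrix n n ℝ) (hq : q.transpose = -q) (e : Edge P) (L : Multiset (Edge P)) :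
    eval q (e.flip ::ₘ L) = eval q (e ::ₘ L) := by
  unfold eval
  refine Finset.sum_congr rfl fun b _ => ?_
  rw [weight_cons, weight_cons, show e.flip.src = e.tgt from rfl, show e.flip.tgt = e.src from rfl, Edge.mat_flip q hq]

/-- kernel (contraction): if the node `p′` is met exactly by the head of `e : p → p′` and the tail of `e′ : p′ → r` (p, r ≠ p′),
summing out the index of `p′` composes the two matrices: (number of indices) · eval(e, e′, L) = eval(e·e′, L).
[cite: Balaban1983Higgs3, p.434] -/
theorem eval_merge (q : Matrix n n ℝ) (e e' : Edge P) (L : Multiset (Edge P)) {p' : P} (he : e.tgt = p') (he' : e'.src = p')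
    (hp : e.src ≠ p') (hr : e'.tgt ≠ p') (hL : ∀ f ∈ L, f.src ≠ p' ∧ f.tgt ≠ p') :
    (Fintype.card n : ℝ) * eval q (e ::ₘ e' ::ₘ L) = eval q (e.merge e' ::ₘ L) := by
  unfold eval
  rw [← sum_sum_update p']
  refine Finset.sum_congr rfl fun b _ => ?_
  simp only [weight_cons, Edge.mat_merge, Matrix.mul_apply, weight_update_of_avoid q hL, Finset.sum_mul]
  refine Finset.sum_congr rfl fun j _ => ?_
  rw [show (e.merge e').src = e.src from rfl, show (e.merge e').tgt = e'.tgt from rfl, he, he',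
    Function.update_self, Function.update_of_ne hp, Function.update_of_ne hr]
  ring

/-- kernel (trace): if the node `p′` is met exactly by the two ends of a self-loop `e : p′ → p′`, summing out the index of `p′`
produces the trace: (number of indices) · eval(e, L) = tr(e) · eval(L). [cite: Balaban1983Higgs3, p.434] -/
theorem eval_loop (q : Matrix n n ℝ) (e : Edge P) (L : Multiset (Edge P)) {p' : P} (hs : e.src = p') (ht : e.tgt = p')
    (hL : ∀ f ∈ L, f.src ≠ p' ∧ f.tgt ≠ p') :
    (Fintype.card n : ℝ) * eval q (e ::ₘ L) = (e.mat q).trace * eval q L := by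
  unfold eval
  rw [← sum_sum_update p']
  simp only [Matrix.trace, Matrix.diag_apply, Finset.sum_mul, Finset.mul_sum]
  refine Finset.sum_congr rfl fun b _ => ?_
  refine Finset.sum_congr rfl fun j _ => ?_
  rw [weight_cons, hs, ht, Function.update_self, weight_update_of_avoid q hL]

/-! ## The vanishing theorem -/

/-- kernel (induction step): `e : p → p′`, p ≠ p′, inside a closed set `C` of degree-2 nodes with odd power; contracting `p′` gives
a network and the node set `C ∖ {p′}` with the same properties and (number of indices) × the value. [cite: Balaban1983Higgs3, p.434] -/
theorem contract_step (q : Matrix n n ℝ) (hq : q.transpose = -q) {e : Edge P} {L : Multiset (Edge P)} {C : Finset P} {p' : P}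
    (he : e.tgt = p') (hp : e.src ≠ p') (hsrc : e.src ∈ C) (hclosed : ∀ f ∈ e ::ₘ L, (f.src ∈ C ↔ f.tgt ∈ C))
    (hdeg : ∀ p ∈ C, deg (e ::ₘ L) p = 2) (hodd : Odd (powIn (e ::ₘ L) C)) :
    ∃ L' : Multiset (Edge P), (∀ f ∈ L', (f.src ∈ C.erase p' ↔ f.tgt ∈ C.erase p')) ∧
      (∀ p ∈ C.erase p', deg L' p = 2) ∧ Odd (powIn L' (C.erase p')) ∧
      (Fintype.card n : ℝ) * eval q (e ::ₘ L) = eval q L' := by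
  have hp'C : p' ∈ C := he ▸ (hclosed e (Multiset.mem_cons_self _ _)).mp hsrc
  -- the continuation once the other edge at p′ is a tail `e′ : p′ → r`
  have key : ∀ (e' : Edge P) (L' : Multiset (Edge P)), e'.src = p' → e'.tgt ≠ p' → (∀ f ∈ L', f.src ≠ p' ∧ f.tgt ≠ p') →
      (∀ f ∈ e ::ₘ e' ::ₘ L', (f.src ∈ C ↔ f.tgt ∈ C)) → (∀ p ∈ C, deg (e ::ₘ e' ::ₘ L') p = 2) →
      Odd (powIn (e ::ₘ e' ::ₘ L') C) →
      ∃ L'' : Multiset (Edge P), (∀ f ∈ L'', (f.src ∈ C.erase p' ↔ f.tgt ∈ C.erase p')) ∧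
        (∀ p ∈ C.erase p', deg L'' p = 2) ∧ Odd (powIn L'' (C.erase p')) ∧
        (Fintype.card n : ℝ) * eval q (e ::ₘ e' ::ₘ L') = eval q L'' := by
    intro e' L' he's he't hL' hcl hdg hod
    have hrC : e'.tgt ∈ C := (hcl e' (by simp)).mp (he's ▸ hp'C)
    refine ⟨e.merge e' ::ₘ L', ?_, ?_, ?_, eval_merge q e e' L' he he's hp he't hL'⟩
    · intro f hf
      rcases Multiset.mem_cons.mp hf with rfl | hf
      · simp only [Edge.merge, Finset.mem_erase]
        exact ⟨fun _ => ⟨he't, hrC⟩, fun _ => ⟨hp, hsrc⟩⟩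
      · rw [Finset.mem_erase, Finset.mem_erase]
        have := hcl f (by simp [hf])
        have := hL' f hf
        tauto
    · intro p hpC
      obtain ⟨hpp', hpC⟩ := Finset.mem_erase.mp hpC
      have h2 := hdg p hpC
      rw [deg_cons, deg_cons, he, he's, if_neg (Ne.symm hpp')] at h2
      rw [deg_cons, show (e.merge e').src = e.src from rfl, show (e.merge e').tgt = e'.tgt from rfl]
      omega
    · have hpe : powIn (e.merge e' ::ₘ L') (C.erase p') = powIn (e.merge e' ::ₘ L') C :=
        powIn_congr fun f hf => by
          rcases Multiset.mem_cons.mp hf with rfl | hf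
          · simp [Edge.merge, Finset.mem_erase, hp]
          · simp [Finset.mem_erase, (hL' f hf).1]
      rw [hpe, powIn_cons, show (e.merge e').src = e.src from rfl, show (e.merge e').pow = e.pow + e'.pow from rfl,
        if_pos hsrc]
      rw [powIn_cons, powIn_cons, if_pos hsrc, he's, if_pos hp'C, ← add_assoc] at hod
      exact hod
  obtain ⟨e₁, L₁, h⟩ := exists_other_end he hp (hdeg p' hp'C)
  rcases h with ⟨he₁s, he₁t, rfl, hL₁⟩ | ⟨he₁t, he₁s, rfl, hL₁⟩
  · exact key e₁ L₁ he₁s he₁t hL₁ hclosed hdeg hodd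
  · -- reverse e₁ first: value, degrees, closedness and powers are unchanged
    have he₁tC : e₁.tgt ∈ C := by rw [he₁t]; exact hp'C
    have he₁sC : e₁.src ∈ C := (hclosed e₁ (by simp)).mpr he₁tC
    have hcl' : ∀ f ∈ e ::ₘ e₁.flip ::ₘ L₁, (f.src ∈ C ↔ f.tgt ∈ C) := by
      intro f hf
      rcases Multiset.mem_cons.mp hf with rfl | hf
      · exact hclosed _ (Multiset.mem_cons_self _ _)
      rcases Multiset.mem_cons.mp hf with rfl | hf
      · exact (hclosed e₁ (by simp)).symm
      · exact hclosed f (by simp [hf])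
    have hdg' : ∀ p ∈ C, deg (e ::ₘ e₁.flip ::ₘ L₁) p = 2 := by
      intro p hpC
      have := hdeg p hpC
      rw [deg_cons, deg_cons] at this ⊢
      rw [show e₁.flip.src = e₁.tgt from rfl, show e₁.flip.tgt = e₁.src from rfl]
      omega
    have hod' : Odd (powIn (e ::ₘ e₁.flip ::ₘ L₁) C) := by
      rw [powIn_cons, powIn_cons] at hodd ⊢
      rw [show e₁.flip.src = e₁.tgt from rfl, show e₁.flip.pow = e₁.pow from rfl, if_pos he₁tC]
      rw [if_pos he₁sC] at hodd
      exact hodd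
    obtain ⟨L'', h1, h2, h3, h4⟩ := key e₁.flip L₁ he₁t he₁s hL₁ hcl' hdg' hod'
    refine ⟨L'', h1, h2, h3, ?_⟩
    rw [← h4, Multiset.cons_swap e e₁.flip L₁, eval_flip q hq e₁ (e ::ₘ L₁), Multiset.cons_swap]

/-- **p. 434** [PDF 24] — the evaluation step of *"every graph of this type has at least one loop of scalar field lines with an
odd number of vector field legs, thus with an odd power of q, and we have tr q^{2n+1} = 0"*, kernel-checked for internal-index
networks: q antisymmetric, `C` a set of nodes closed under the edges (tail in C iff head in C), every node of C met by exactly two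
edge-ends (the edges inside C form closed loops), the edges inside C carrying an odd total power of q ⇒ the index sum `eval q L`
vanishes (induction on |C|: contracting a node composes consecutive matrices ±q^a, ±q^b into ±q^{a+b}; a loop shrunk to a
self-loop contributes tr(±q^m), m the power of the loop, = 0 when m is odd). [cite: Balaban1983Higgs3, p.434] -/
theorem eval_eq_zero_of_odd [Nonempty n] (q : Matrix n n ℝ) (hq : q.transpose = -q) :
    ∀ (N : ℕ) (L : Multiset (Edge P)) (C : Finset P), C.card = N → (∀ e ∈ L, (e.src ∈ C ↔ e.tgt ∈ C)) →
      (∀ p ∈ C, deg L p = 2) → Odd (powIn L C) → eval q L = 0 := by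
  have hcard : (Fintype.card n : ℝ) ≠ 0 := Nat.cast_ne_zero.mpr Fintype.card_ne_zero
  intro N
  induction N with
  | zero =>
    intro L C hC _ _ hodd
    rw [Finset.card_eq_zero.mp hC, powIn_eq_zero_of_forall (L := L) (fun e _ => Finset.notMem_empty _)] at hodd
    exact absurd hodd (by decide)
  | succ N ih =>
    intro L C hC hclosed hdeg hodd
    -- an edge issuing from C exists (the power carried by C is odd, hence nonzero)
    obtain ⟨e, heL, heC⟩ : ∃ e ∈ L, e.src ∈ C := by
      by_contra h
      have h' : ∀ e ∈ L, e.src ∉ C := fun e he hC => h ⟨e, he, hC⟩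
      rw [powIn_eq_zero_of_forall h'] at hodd
      exact absurd hodd (by decide)
    obtain ⟨L₁, rfl⟩ := Multiset.exists_cons_of_mem heL
    have htC : e.tgt ∈ C := (hclosed e (Multiset.mem_cons_self _ _)).mp heC
    have hcard' : (C.erase e.tgt).card = N := by rw [Finset.card_erase_of_mem htC, hC]; omega
    by_cases hself : e.src = e.tgt
    · -- `e` is a self-loop at its node: trace it off
      have h2 := hdeg e.tgt htC
      rw [deg_cons, if_pos hself, if_pos rfl] at h2
      have hL₁ : ∀ f ∈ L₁, f.src ≠ e.tgt ∧ f.tgt ≠ e.tgt := avoid_of_deg_eq_zero (by omega)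
      have hloop := eval_loop q e L₁ hself rfl hL₁
      rcases Nat.even_or_odd e.pow with heven | hodd'
      · have hrest : eval q L₁ = 0 := by -- even self-loop: the rest of C still carries an odd power
          refine ih L₁ (C.erase e.tgt) hcard' (fun f hf => ?_) (fun p hp => ?_) ?_
          · rw [Finset.mem_erase, Finset.mem_erase]
            have := hclosed f (by simp [hf])
            have := hL₁ f hf
            tauto
          · obtain ⟨hpp', hpC⟩ := Finset.mem_erase.mp hp
            have := hdeg p hpC
            rw [deg_cons, hself, if_neg (Ne.symm hpp')] at this
            omega
          · rw [powIn_congr (C' := C) (fun f hf => by simp [Finset.mem_erase, (hL₁ f hf).1])]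
            rw [powIn_cons, if_pos heC] at hodd
            exact (Nat.odd_add'.mp hodd).mpr heven
        have : (Fintype.card n : ℝ) * eval q (e ::ₘ L₁) = 0 := by rw [hloop, hrest, mul_zero]
        exact (mul_eq_zero.mp this).resolve_left hcard
      · have : (Fintype.card n : ℝ) * eval q (e ::ₘ L₁) = 0 := by -- odd self-loop: tr(±q^odd) = 0
          rw [hloop, Edge.trace_mat_eq_zero q hq e hodd', zero_mul]
        exact (mul_eq_zero.mp this).resolve_left hcard
    · -- `e : p → p′` with p ≠ p′: contract p′
      obtain ⟨L', h1, h2, h3, h4⟩ := contract_step q hq rfl hself heC hclosed hdeg hodd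
      have hrest : eval q L' = 0 := ih L' (C.erase e.tgt) hcard' h1 h2 h3
      rw [hrest] at h4
      exact (mul_eq_zero.mp h4).resolve_left hcard

/-- **p. 434**, packaged: for antisymmetric q, a closed loop structure (closed node set of degree-2 nodes) carrying an odd power of
q forces the whole index sum to vanish. [cite: Balaban1983Higgs3, p.434] -/
theorem eval_eq_zero_of_odd_closed [Nonempty n] (q : Matrix n n ℝ) (hq : q.transpose = -q) (L : Multiset (Edge P))
    (C : Finset P) (hclosed : ∀ e ∈ L, (e.src ∈ C ↔ e.tgt ∈ C)) (hdeg : ∀ p ∈ C, deg L p = 2) (hodd : Odd (powIn L C)) :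
    eval q L = 0 :=
  eval_eq_zero_of_odd q hq C.card L C rfl hclosed hdeg hodd

/-! ## Non-vacuity: an even loop does not vanish -/

/-- The charge matrix of the abelian Higgs model on ℝ² (multiplication by i), cf. `B3Sect2StatementsPart2.chargeMatrix_transpose`.
[cite: Balaban1983Higgs3, p.434] -/
def chargeMatrix : Matrix (Fin 2) (Fin 2) ℝ := !![0, -1; 1, 0]

/-- kernel: the two-node loop with powers 1 and 1 (the index structure of the lowest-order vector self-energy graph (3.25): two
bilinear forms ⟨φ′, qφ′⟩ joined by two scalar lines, after contracting the lines) evaluates to tr q² = −2 ≠ 0 for the charge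
matrix — the parity hypothesis of `eval_eq_zero_of_odd_closed` cannot be dropped. [cite: Balaban1983Higgs3, p.434] -/
theorem eval_twoCycle :
    eval chargeMatrix ({⟨0, 1, 1, 1⟩, ⟨1, 0, 1, 1⟩} : Multiset (Edge (Fin 2))) = -2 := by
  have hmat : ∀ (a b : Fin 2) (i j : Fin 2), Edge.mat chargeMatrix (⟨a, b, 1, 1⟩ : Edge (Fin 2)) i j = chargeMatrix i j := by
    intro a b i j; simp [Edge.mat]
  unfold eval
  rw [← Equiv.sum_comp (finTwoArrowEquiv (Fin 2)).symm, Fintype.sum_prod_type, Fin.sum_univ_two, Fin.sum_univ_two,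
    Fin.sum_univ_two]
  simp only [weight, Multiset.insert_eq_cons, Multiset.map_cons, Multiset.map_singleton, Multiset.prod_cons,
    Multiset.prod_singleton, finTwoArrowEquiv_symm_apply, Matrix.cons_val_zero, Matrix.cons_val_one, hmat]
  norm_num [chargeMatrix]

end Literature.MathematicalPhysics.QuantumFieldTheory.Balaban1983to89.B3IndexNetworks
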